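import Literature.NumberTheory.EllipticCurves.IwasawaLeadingTerm
import Literature.NumberTheory.EllipticCurves.CanonicalPAdicHeightHolds
import Literature.NumberTheory.EllipticCurves.BSDSelmerParityDokchitserProofs
import Literature.NumberTheory.EllipticCurves.RationalIsogenyFrobeniusCriterion
import Literature.NumberTheory.EllipticCurves.PointCountEulerCriterion
import Literature.NumberTheory.EllipticCurves.PAdicLFunctionRiemannSumCertificateProofs
import Summits.BirchSwinnertonDyer.BirchSwinnertonDyer.Theorems.LeadingTermPinchPrimeSchneiderShaOfPinchAtKato
import HarnessLib

/-!
# BirchSwinnertonDyer — rank ≥ 2 observatory: the `p`-adic row of a census cell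

HONEST FRAMING: per-curve certified theorems and census instruments; no claim on BSD in rank ≥ 2.

The Schneider / `p`-adic BSD census of the observatory (cell seats padic-1/2/3, plan `PADIC-PLAN.md`)
records, for a curve `E/ℚ` of certified Mordell–Weil rank `r ∈ {2, 3}` and a good ordinary prime
`p ≥ 5`, two independently computed quantities: the cyclotomic `p`-adic regulator (H-side) and the
order of vanishing / leading coefficient of the `p`-adic `L`-series `L_p(E,T)` (L-side), each by two
engines sharing no library (engine A: PARI/GP, Harvey/Mazur–Stein–Tate sigma + modular-symbol Riemann
sums; engine B: SageMath). This file — the first module of the series `Rank2ObservatoryPadic*.lean`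
(`…PadicRow` generic squeeze, `…PadicRowCells` two cells with every decidable input in the kernel,
`…PadicSymbolTable` / `…PadicSymbolTableL` the Riemann sum as a KERNEL computation from a table of
plus modular symbols at level `p²` / `p^{n+1}`, `…PadicSymbolCells389a1` / `…5077a1` the eight
two-engine cells of the showcase curves, `…PadicAtlasKit` + `…PadicAtlasR2A*` the machine-written
atlas of every two-engine cell of the rank-2 census) — is the kernel-checked form of WHAT ONE
CERTIFIED CELL PROVES, for an arbitrary `W/ℚ`, with every deep input a NAMED hypothesis taken from
the tree's Literature (nothing minted here):

* `hkato : kato_divisibility W p` for all cyclotomic data `(κ, γ)` — K. Kato, Astérisque 295 (2004),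
  Thm. 17.4: `X(E/ℚ_∞)` is `Λ`-torsion and `char_Λ X ∣ p^n · L_p(E,T)`;
* `hPRS : Schneider1985_order_charGenerator` — Perrin-Riou / Schneider as printed in
  Balakrishnan–Müller–Stein, Math. Comp. 85 (2016), Thm. 1.7: `rank ≤ ord_{T=0} f_E`, with equality
  iff the canonical `p`-adic height is non-degenerate and `Ш(E/ℚ)[p^∞]` is finite;
* `hf : IsNewformOf W f` — modularity (the newform whose modular symbols engine A integrates);
* `hlow : r ≤ rank_ℤ E(ℚ)` — the rank certificate of the cell seats cert-1/2/3 (`r` independent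
  points, two engines; `Rank2Observatory<label>.lean`, `Rank2ObservatoryKernelCerts*.lean`);
* `hLp : [T^r] L_p(f, α_p, T) ≠ 0` — THE `p`-ADIC CELL CERTIFICATE: the `r`-th coefficient of the
  tree's `padicLFunction f (unitRoot W p)` (Mazur–Tate–Teitelbaum, `[·]⁺` normalised by `Ω⁺_f`,
  `γ = 1 + p`, `padicLCoeff = lim` of the Riemann sums `padicLRiemannSum`) is non-zero. Engine A
  evaluates exactly these Riemann sums at level `p^n` with PARI `msfromell` symbols and certifies
  `[T^r] ≢ 0 (mod p^a)` above the proven truncation error; engine B uses Sage's overconvergent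
  modular symbols. A RED cell (engines disagree) produces no theorem (anomaly protocol).
  `padicRow_of_riemannSum_certificate` takes the certificate in exactly the form the engines emit
  it — a bound `C` for the measure `μ_{f,α_p}` and ONE level-`n` Riemann sum with
  `(C/‖r!‖_p)·p^{-n} < ‖RS(r, n)‖` — and derives `hLp` from the tree's unconditional truncation
  bound (`norm_padicLCoeff_eq_of_lt`, MTT §I.11–I.13); the later modules make `RS(r, n)` itself a
  kernel computation from the engines' raw input.

Conclusion (`padicRow_of_certificate`): `rank_ℤ E(ℚ) = r`, `ord_{T=0} L_p(E,T) = r` EXACTLY,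
`Ш(E/ℚ)[p^∞]` is finite, the canonical `p`-adic height pairing is non-degenerate (Schneider's
conjecture holds at `(E, p)`), `corank_{ℤ_p} Sel_{p^∞}(E/ℚ) = r`, and the Perrin-Riou–Schneider
leading-term valuation identity holds for a generator `f_E` of `char_Λ X(E/ℚ_∞)`. Proof: Kato gives
`rank ≤ ord f_E ≤ ord L_p` (`f_E ∣ g`, `ι g = p^n L_p`), the certificate gives `ord L_p ≤ r ≤ rank`,
so all four are equal and PRS clause 2 converts `ord f_E = rank` into Schneider + finiteness of
`Ш[p^∞]`. The Kato step in ORDER form (`X` torsion, `ord f_E ≤ ord g ≤ ord ι g = ord L_p`) is the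
tree's `Cruxes.PinchPrime.FirstLayerStability.isTorsion_and_order_charGenerator_le_order_padicLFunction_of_kato`
(imported, not re-derived); the same chain, read as the NECESSITY of the same-prime pair, is its
`stub_schneiderSha_of_pinchAt_kato`.

What is NOT claimed: nothing about `ord_{s=1} L(E,s)`, nothing about `#Ш`, and no statement for
`p ≤ 3`, supersingular or bad `p` (outside the tree's canonical-height API). The `p`-adic BSD
formula itself (`[T^r] L_p` versus `Reg_p · #Ш · ∏ c_v / #E_tors²`) is the census's `Sha_an` column and
is NOT asserted here.

DATA (provenance, not theorems). Tables of record (HOME = `run/shared/lean/b2b/bsd-rank2-observatory/`):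
`data/padic/DIFF/DIFF_R2A.tsv` (sha256 `fbdaf8ca108cf73010e80065cab1e0a894fb635bf799dba340a09f5676c9afae`,
24 189 cells `(E, p)`, `E` of rank 2 with `N < 35 000`, `5 ≤ p ≤ 23` good ordinary; 629 cells
`certified(H+L)` = both sides by two engines, 15 583 `certified(H)`), `DIFF_R3A.tsv`
(sha256 `98be75643c96e9b826cb2cf5df0f28cb9809a50f48af99d4a930584c330dac8c`; rank 3, 4 cells
`certified(H+L)`: 5077a1 at `p = 5, 7, 11, 13`), engine-A tables `data/padic/R2A-tables/LSIDE_R2A.tsv`,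
`R3A-tables/LSIDE_R3A.tsv`, the symbol tables `data/padic/symtab/SYMTAB_R2A.jsonl` (kit `j085965`),
methods `b2b-bsdr2-padic-1/METHODS-A.md`, `PADIC-PLAN.md` §2. 0 anomalies under verification at the
close of generation 2; any disagreement would first be an anomaly under verification (second engine,
referee, literature), never a claim.

References: K. Kato, Astérisque 295 (2004), Thm. 17.4; P. Schneider, Invent. Math. 79 (1985);
B. Perrin-Riou, Ann. Inst. Fourier 43 (1993); J. Balakrishnan, J. S. Müller, W. Stein, Math. Comp. 85
(2016), Thm. 1.7; B. Mazur, W. Stein, J. Tate, Doc. Math. Extra Vol. (2006), §1; W. Stein,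
C. Wuthrich, Math. Comp. 82 (2013), §3–§4; B. Mazur, J. Tate, J. Teitelbaum, Invent. Math. 84 (1986), §I.13.
-/

-- single-conjunct summit: `Summit.BirchSwinnertonDyer.BirchSwinnertonDyer.…` repeats the name by design
set_option linter.dupNamespace false

noncomputable section

open scoped Classical

namespace Summit.BirchSwinnertonDyer.BirchSwinnertonDyer.Rank2Observatory

open scoped MatrixGroups ModularForm
open CongruenceSubgroup Literature.NumberTheory.EllipticCurves
  Literature.NumberTheory.EllipticCurves.ModularForms WeierstrassCurve
open Cruxes.PinchPrime.FirstLayerStability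
  (isTorsion_and_order_charGenerator_le_order_padicLFunction_of_kato)

/-! ### The `p`-adic row of a certified cell -/

/-- **The squeeze of a certified cell.** At a good ordinary `p ≥ 5` with newform `f`, Kato's
divisibility for all cyclotomic data (hypothesis) and the two certificates `r ≤ rank_ℤ E(ℚ)` (`hlow`)
and `[T^r] L_p(f, α_p, T) ≠ 0` (`hLp`) force `rank_ℤ E(ℚ) = r` and `ord_{T=0} L_p = r`:
`r ≤ rank ≤ ord L_p ≤ r` (Kato's rank bound `kato_mordellWeilRank_le_order_padicLFunction_of_kato_divisibility`).
[cite: Kato2004Asterisque, Thm. 17.4 (p. 273) and Thm. 18.4 (p. 281)] -/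
theorem rank_eq_and_order_eq_of_certificate
    (W : WeierstrassCurve ℚ) [W.IsElliptic] [W.IsGloballyMinimal] (p : ℕ) [Fact p.Prime]
    {N : ℕ} [NeZero N] {f : CuspForm (Gamma0 N) 2}
    (hkato : ∀ (κ : ZpExtension ℚ p) (γ : Field.absoluteGaloisGroup ℚ),
      kato_divisibility W p (κ := κ) (γ := γ) (f := f))
    (hp : p ≠ 2) (hord : IsOrdinaryAt W p) (hf : IsNewformOf W f)
    {r : ℕ} (hlow : r ≤ W.mordellWeilRank)
    (hLp : PowerSeries.coeff r (padicLFunction f (unitRoot W p : ℚ_[p])) ≠ 0) :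
    W.mordellWeilRank = r ∧ (padicLFunction f (unitRoot W p : ℚ_[p])).order = r := by
  have hk : (W.mordellWeilRank : ℕ∞) ≤ (padicLFunction f (unitRoot W p : ℚ_[p])).order :=
    kato_mordellWeilRank_le_order_padicLFunction_of_kato_divisibility W p hkato hp hord hf
  have hle : (padicLFunction f (unitRoot W p : ℚ_[p])).order ≤ r := PowerSeries.order_le r hLp
  have hrank : W.mordellWeilRank ≤ r := by exact_mod_cast hk.trans hle
  have hr : W.mordellWeilRank = r := le_antisymm hrank hlow
  refine ⟨hr, le_antisymm hle ?_⟩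
  rw [← hr]
  exact hk

/-- **The `p`-adic row of a certified census cell `(E, p)`** (the observatory's Schneider / `p`-adic
BSD census; per-curve certified theorems and census instruments, no claim on BSD in rank ≥ 2).
For `W/ℚ` globally minimal elliptic, `p ≥ 5` good ordinary, `f` the newform of `W`; INPUTS as named
hypotheses: `hPRS` (Perrin-Riou–Schneider, BMS Thm. 1.7), `hkato` (Kato Thm. 17.4 for all cyclotomic
data), `hlow : r ≤ rank_ℤ E(ℚ)` (rank certificate), `hLp : [T^r] L_p(f, α_p, T) ≠ 0` (`p`-adic cell
certificate, two engines). OUTPUT: `rank_ℤ E(ℚ) = r`, `ord_{T=0} L_p = r`, `Ш(E/ℚ)[p^∞]` finite, and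
every canonical cyclotomic `p`-adic height datum is non-degenerate (`Reg_p(E) ≠ 0`, Schneider's
conjecture at `(E,p)`; such a datum exists, `exists_isCanonical_holds`). Chain:
`r ≤ rank ≤ ord f_E ≤ ord L_p ≤ r` for a generator `f_E` of `char_Λ X(E/ℚ_∞)`
(`charIdeal_isPrincipal_holds`), then PRS clause 2. [cite: BalakrishnanMullerStein2015, Thm. 1.7]
[cite: Kato2004Asterisque, Thm. 17.4 (p. 273)] [cite: MazurSteinTate2006, Conj. 1.1] -/
theorem padicRow_of_certificate (hPRS : Schneider1985_order_charGenerator)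
    (W : WeierstrassCurve ℚ) [W.IsElliptic] [W.IsGloballyMinimal] (p : ℕ) [Fact p.Prime]
    {N : ℕ} [NeZero N] {f : CuspForm (Gamma0 N) 2}
    (hkato : ∀ (κ : ZpExtension ℚ p) (γ : Field.absoluteGaloisGroup ℚ),
      kato_divisibility W p (κ := κ) (γ := γ) (f := f))
    (h5 : 5 ≤ p) (hord : IsOrdinaryAt W p) (hf : IsNewformOf W f)
    {r : ℕ} (hlow : r ≤ W.mordellWeilRank)
    (hLp : PowerSeries.coeff r (padicLFunction f (unitRoot W p : ℚ_[p])) ≠ 0) :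
    W.mordellWeilRank = r ∧ (padicLFunction f (unitRoot W p : ℚ_[p])).order = r ∧
      Finite (AddCommGroup.primaryComponent W.sha p) ∧
      ∀ Dh : PAdicHeightData W p, Dh.IsCanonical → SchneiderConjecture Dh := by
  obtain ⟨hr, horder⟩ := rank_eq_and_order_eq_of_certificate W p hkato (by omega) hord hf hlow hLp
  -- the cyclotomic datum, the Iwasawa datum, a generator of `char X`
  obtain ⟨κ, hκ, γ, hγ, hγ'⟩ := exists_isCyclotomic_isTopGenerator_isCyclotomicVariable_holds p
  obtain ⟨D⟩ := W.nonempty_selmerDualData_holds κ γ hγ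
  haveI : Module.Finite (IwasawaAlgebra p) D.X := D.module_finite_of_isCyclotomic W κ hκ hγ
  obtain ⟨fE, hfE⟩ : ∃ fE : IwasawaAlgebra p, D.charIdeal = Ideal.span {fE} := by
    have hP : (D.charIdeal).IsPrincipal := charIdeal_isPrincipal_holds p D.X
    exact ⟨hP.generator, (Ideal.span_singleton_generator D.charIdeal).symm⟩
  obtain ⟨hX, hle⟩ := isTorsion_and_order_charGenerator_le_order_padicLFunction_of_kato W p
    (hkato κ γ) (by omega) hord hκ hγ hγ' hf D fE hfE
  -- a canonical height datum exists (`p ≥ 5` good ordinary)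
  obtain ⟨Dh₀, hDh₀⟩ := WeierstrassCurve.exists_isCanonical_holds W p h5 hord.1 hord.2
  -- `ord f_E = rank`
  have hfEord : fE.order = W.mordellWeilRank := by
    refine le_antisymm ?_ (hPRS W p h5 hord.1 hord.2 κ γ hκ hγ hγ' D hX fE hfE Dh₀ hDh₀).1
    rw [hr, ← horder]
    exact hle
  have key : ∀ Dh : PAdicHeightData W p, Dh.IsCanonical →
      SchneiderConjecture Dh ∧ Finite (AddCommGroup.primaryComponent W.sha p) := fun Dh hDh ↦
    (hPRS W p h5 hord.1 hord.2 κ γ hκ hγ hγ' D hX fE hfE Dh hDh).2.1.mp hfEord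
  exact ⟨hr, horder, (key Dh₀ hDh₀).2, fun Dh hDh ↦ (key Dh hDh).1⟩

/-- **Corollary: the `p^∞`-Selmer corank of a certified cell is `r`** (`corank Sel_{p^∞}(E/ℚ) =
rank + corank Ш[p^∞]`, tree theorem `selmerCorank_eq_mordellWeilRank_add_holds`, and `Ш[p^∞]` is
finite). [cite: BalakrishnanMullerStein2015, Thm. 1.7] [cite: Kato2004Asterisque, Thm. 17.4 (p. 273)] -/
theorem selmerCorank_eq_of_certificate (hPRS : Schneider1985_order_charGenerator)
    (W : WeierstrassCurve ℚ) [W.IsElliptic] [W.IsGloballyMinimal] (p : ℕ) [Fact p.Prime]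
    {N : ℕ} [NeZero N] {f : CuspForm (Gamma0 N) 2}
    (hkato : ∀ (κ : ZpExtension ℚ p) (γ : Field.absoluteGaloisGroup ℚ),
      kato_divisibility W p (κ := κ) (γ := γ) (f := f))
    (h5 : 5 ≤ p) (hord : IsOrdinaryAt W p) (hf : IsNewformOf W f)
    {r : ℕ} (hlow : r ≤ W.mordellWeilRank)
    (hLp : PowerSeries.coeff r (padicLFunction f (unitRoot W p : ℚ_[p])) ≠ 0) :
    W.selmerCorank p = r := by
  obtain ⟨hr, -, hfin, -⟩ := padicRow_of_certificate hPRS W p hkato h5 hord hf hlow hLp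
  haveI := hfin
  rw [W.selmerCorank_eq_mordellWeilRank_add_holds p, hr, WeierstrassCurve.shaCorank,
    zpCorank_eq_zero_of_finite _ p, add_zero]

/-- **Corollary: the Perrin-Riou–Schneider leading-term identity holds at a certified cell.** With
the inputs of `padicRow_of_certificate`, for the cyclotomic datum, every finitely generated Iwasawa
datum `D`, every generator `f_E` of `char_Λ X` and every canonical height datum `Dh`:
`ord_{T=0} f_E = r` and there is a unit `u ∈ ℤ_pˣ` with
`[T^r] f_E · log_p(γ_cyc)^r · #E(ℚ)_tors² = u · (1 − α_p⁻¹)² · #Ш[p^∞] · Reg_p(E, Dh) · ∏ c_v`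
(BMS Thm. 1.7 clause 3; both `Reg_p ≠ 0` and `#Ш[p^∞] < ∞` are now known at this cell).
[cite: BalakrishnanMullerStein2015, Thm. 1.7 and p. 3] [cite: Kato2004Asterisque, Thm. 17.4 (p. 273)] -/
theorem leadingTerm_of_certificate (hPRS : Schneider1985_order_charGenerator)
    (W : WeierstrassCurve ℚ) [W.IsElliptic] [W.IsGloballyMinimal] (p : ℕ) [Fact p.Prime]
    {N : ℕ} [NeZero N] {f : CuspForm (Gamma0 N) 2}
    (hkato : ∀ (κ : ZpExtension ℚ p) (γ : Field.absoluteGaloisGroup ℚ),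
      kato_divisibility W p (κ := κ) (γ := γ) (f := f))
    (h5 : 5 ≤ p) (hord : IsOrdinaryAt W p) (hf : IsNewformOf W f)
    {r : ℕ} (hlow : r ≤ W.mordellWeilRank)
    (hLp : PowerSeries.coeff r (padicLFunction f (unitRoot W p : ℚ_[p])) ≠ 0)
    {κ : ZpExtension ℚ p} {γ : Field.absoluteGaloisGroup ℚ} (hκ : κ.IsCyclotomic)
    (hγ : κ.IsTopGenerator γ) (hγ' : IsCyclotomicVariable p γ)
    (D : W.SelmerDualData κ γ) [Module.Finite (IwasawaAlgebra p) D.X]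
    (fE : IwasawaAlgebra p) (hfE : D.charIdeal = Ideal.span {fE})
    (Dh : PAdicHeightData W p) (hDh : Dh.IsCanonical) :
    fE.order = r ∧
      ∃ u : ℤ_[p]ˣ,
        ((PowerSeries.coeff r fE : ℤ_[p]) : ℚ_[p]) * padicLog p (cyclotomicGenerator p) ^ r *
            (W.torsionOrder : ℚ_[p]) ^ 2 =
          ((u : ℤ_[p]) : ℚ_[p]) *
            ((1 - (unitRoot W p : ℚ_[p])⁻¹) ^ 2 *
              ((Nat.card (AddCommGroup.primaryComponent W.sha p) : ℚ_[p]) *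
                padicRegulator Dh * W.tamagawaProduct)) := by
  obtain ⟨hr, horder, hfin, hS⟩ := padicRow_of_certificate hPRS W p hkato h5 hord hf hlow hLp
  obtain ⟨hX, hle⟩ := isTorsion_and_order_charGenerator_le_order_padicLFunction_of_kato W p
    (hkato κ γ) (by omega) hord hκ hγ hγ' hf D fE hfE
  have h := hPRS W p h5 hord.1 hord.2 κ γ hκ hγ hγ' D hX fE hfE Dh hDh
  have hfEord : fE.order = W.mordellWeilRank := by
    refine le_antisymm ?_ h.1
    rw [hr, ← horder]
    exact hle
  subst hr
  exact ⟨hfEord, h.2.2 (hS Dh hDh) hfin⟩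

/-! ### The cell certificate in Riemann-sum form (the form the engines emit) -/

/-- **The `p`-adic cell certificate in the form the engines emit it: one Riemann sum above the
truncation error.** The engines never see `[T^r] L_p(f, α_p, T)` itself: they compute the RIEMANN
SUM `RS(r, n) = padicLRiemannSum f α_p r n` at a finite level `n` (engine A: `n` = column `level_n`
of `LSIDE_*.tsv`; engine B: `nL`) and a bound `C` for the Mazur–Swinnerton-Dyer measure
(`‖μ_{f,α_p}(a + p^m ℤ_p)‖ ≤ C` for all `m, a`; in practice `C = p^B`, `B` the `p`-adic denominator
bound of the plus modular symbol, which is what the engines' `absprec` bookkeeping records). The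
tree's truncation bound `‖[T^r] L_p − RS(r, n)‖ ≤ (C/‖r!‖_p)·p^{-n}` (`norm_padicLCoeff_eq_of_lt`,
from the distribution relation `msdMeasure_distribution_of_isNewformOf`, unconditional) turns the
single inequality `(C/‖r!‖_p)·p^{-n} < ‖RS(r, n)‖` — i.e. "`[T^r] P_n` is non-zero to the certified
absolute precision" — into `[T^r] L_p ≠ 0`. The inequality is invariant under rescaling `μ` and `C`
by the same non-zero rational, so the period normalisation (`Ω_E` in engine A, `Ω_f⁺` in the tree)
is immaterial. [cite: MazurTateTeitelbaum1986Invent, §I.11–I.13]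
[cite: SteinWuthrich2013, §3] -/
theorem coeff_ne_zero_of_riemannSum_certificate (W : WeierstrassCurve ℚ) [W.IsElliptic]
    [W.IsGloballyMinimal] (p : ℕ) [Fact p.Prime] {N : ℕ} [NeZero N] {f : CuspForm (Gamma0 N) 2}
    (hord : IsOrdinaryAt W p) (hf : IsNewformOf W f) {C : ℝ}
    (hC : ∀ (m : ℕ) (a : ZMod (p ^ m)), ‖msdMeasure f (unitRoot W p : ℚ_[p]) m a‖ ≤ C) {r n : ℕ}
    (hlt : C / ‖((r.factorial : ℕ) : ℚ_[p])‖ * (p : ℝ) ^ (-n : ℤ) <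
      ‖padicLRiemannSum f (unitRoot W p : ℚ_[p]) r n‖) :
    PowerSeries.coeff r (padicLFunction f (unitRoot W p : ℚ_[p])) ≠ 0 := by
  rw [coeff_padicLFunction]
  exact (norm_padicLCoeff_eq_of_lt (msdMeasure_distribution_of_isNewformOf hord hf)
    ((norm_nonneg _).trans (hC 0 0)) hC hlt).2

/-- **The `p`-adic row from the engines' actual output.** `padicRow_of_certificate` with the cell
certificate supplied in Riemann-sum form: a measure bound `C` and ONE level-`n` Riemann sum with
`(C/‖r!‖_p)·p^{-n} < ‖RS(r, n)‖`. OUTPUT as before: `rank_ℤ E(ℚ) = r`, `ord_{T=0} L_p = r`,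
`Ш(E/ℚ)[p^∞]` finite, Schneider non-degeneracy for every canonical height datum.
[cite: BalakrishnanMullerStein2015, Thm. 1.7] [cite: Kato2004Asterisque, Thm. 17.4 (p. 273)]
[cite: MazurTateTeitelbaum1986Invent, §I.11–I.13] -/
theorem padicRow_of_riemannSum_certificate (hPRS : Schneider1985_order_charGenerator)
    (W : WeierstrassCurve ℚ) [W.IsElliptic] [W.IsGloballyMinimal] (p : ℕ) [Fact p.Prime]
    {N : ℕ} [NeZero N] {f : CuspForm (Gamma0 N) 2}
    (hkato : ∀ (κ : ZpExtension ℚ p) (γ : Field.absoluteGaloisGroup ℚ),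
      kato_divisibility W p (κ := κ) (γ := γ) (f := f))
    (h5 : 5 ≤ p) (hord : IsOrdinaryAt W p) (hf : IsNewformOf W f)
    {r : ℕ} (hlow : r ≤ W.mordellWeilRank) {C : ℝ}
    (hC : ∀ (m : ℕ) (a : ZMod (p ^ m)), ‖msdMeasure f (unitRoot W p : ℚ_[p]) m a‖ ≤ C) {n : ℕ}
    (hlt : C / ‖((r.factorial : ℕ) : ℚ_[p])‖ * (p : ℝ) ^ (-n : ℤ) <
      ‖padicLRiemannSum f (unitRoot W p : ℚ_[p]) r n‖) :
    W.mordellWeilRank = r ∧ (padicLFunction f (unitRoot W p : ℚ_[p])).order = r ∧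
      Finite (AddCommGroup.primaryComponent W.sha p) ∧
      ∀ Dh : PAdicHeightData W p, Dh.IsCanonical → SchneiderConjecture Dh :=
  padicRow_of_certificate hPRS W p hkato h5 hord hf hlow
    (coeff_ne_zero_of_riemannSum_certificate W p hord hf hC hlt)

end Summit.BirchSwinnertonDyer.BirchSwinnertonDyer.Rank2Observatory

end
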